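import Literature.MathematicalPhysics.QuantumFieldTheory.Balaban1983to89.B6Geom246MultiLevelTorus

/-!
# `Balaban1983to89.B6TorusDepthDistance` — T. Bałaban, *Propagators and renormalization transformations for lattice gauge theories. II*,
# Commun. Math. Phys. **96** (1984) 223–250 [Balaban1984PropagatorsII], (2.45)–(2.46) p. 231 with (2.36) p. 229: THE TORUS DISTANCE (2.46) OF A DEEP BLOCK
# IS THE BOX DISTANCE UNLESS IT IS LARGE — `d_T(a, x) ≥ min(d_box(a, x), (w − 2)/L^{j(a)+1}, R·M)` for a block `a` whose sites are `w`-deep in the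
# fundamental box (the geometric input for reading the box-built partition {h_□} (2.36) of a CENTRAL cube in the torus metric, B6-CLOSURE §5 item 9)

statement-level skeleton of published theorems with citation tags; proofs where landed; nothing here is a claim about the Yang–Mills mass gap

PDF held: `paper:balaban1984-cmp96-propagators-rt-ii` (journal page = PDF page + 222): p. 229 [PDF 7] ((2.36)), p. 231 [PDF 9] ((2.45)–(2.46)), p. 247 [PDF 25]
((2.134)).  PRINT p. 247 (verbatim): *"Applying the inequalities (2.133), (2.88) and the remarks after the inequality (2.68) we obtain
|(K_{□,□′}G_{□′}h_{□′}J)(x)| ≤ O(M⁻¹)e^{−½δ₂d(y,y′)}|J| (2.134)"*.  READING (ours, NOT print — the page displays only (2.134)): the two partition sizes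
this port transports, «h_□′(x′) − h_□′(x) = O(1)M^{−1}d(y, y′)» (the block-Lipschitz binder `hLip`) and «ζ_□ − 1 = 0 within distance M of □» (the gap
binder `hgap`), are our gloss of how the factor O(M⁻¹) of (2.134) arises from *"the remarks after the inequality (2.68)"*; they are hypotheses of the
(2.134) theorems of record (`…B6Ineq2134Diag`, `…B6Ineq2134OffDiag`), not printed sentences (referee ref-1 g77, F1).

CITATION HEADER (lean-in-tree rule) — WHAT IS REPRODUCED.  Phase-2 file of the `lit-balaban` typed skeleton (HOME `run/shared/lean/pub/lit-balaban/`), seat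
**p38 gen 25**; B6-CLOSURE §5 item 9 / GAPS G-B6-p38-04: the (2.36)/(2.134) partition binders are certified in the BOX distance `(bond D).dist` (p21
`…B6Geom246MultiLevelBox`); the torus consumers need the TORUS distance `(bondT D).dist ≤ (bond D.toDomains).dist` (p21 `…B6Geom246MultiLevelTorus`).
Print builds every torus cube as a central cube of a translated fundamental box (p21 `…B6Eq238MultiLevelTorus`); THIS FILE proves the geometric facts that make
the box-metric binders of such a cube usable in the torus metric:
* §1 `min_le_torusSupNorm_sub`: `min(|x − x′|_∞, w) ≤ |x − x′|_T` for a `w`-deep site `x` (no short wrap-around from a deep site);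
* §2 `BlkDeep`; `touch_of_touchT_deep` (a 2-deep block touching a block ON THE TORUS touches it IN THE BOX); `blkDeep_of_touch` (depth drops by `≤ L^i` per bond);
* §3 `boxWalk_of_torusWalk_deep` (a torus contour of `n` bonds from a `w`-deep block through levels `≤ i`, `2 + n·L^i ≤ w`, IS a box contour) and
  **`distT_trichotomy`**: for a `w`-deep block `a` and any `x`, `n := d_T(a, x)`: EITHER `d_box(a, x) = n`, OR `w < 2 + n·L^{j(a)+1}`, OR `R·(L·M_h) ≤ n`
  ((2.60) `levelGapT`); corollary `dist_box_eq_distT_of_lt`;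
* §4 p21's translation charts (`D.chart s`, `blkMap`) are ISOMETRIES of the torus distance: `touchT_chart_iff`, `blkIsoT : bondT (D.chart s) ≃g bondT D`,
  `distT_chart_eq`, `dist_chart_eq_distT_of_lt`;
* §5 TRANSFER OF THE TWO (2.134) BINDERS from a chart's box metric to the torus metric (data supported in `w`-deep blocks of level `≤ j + 1`; threshold `T > 0`,
  `T·L^{j+2} ≤ w − 2`, `T < R·M`): `lip_transfer` (`(s/M)(d_box + r₀)` ⇒ `(max(s, 2M/T)/M)(d_T + r₀)` for `pullT s f`) and `gap_transfer` (`m·M ≤ d_box` ⇒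
  `min(m, T/M)·M ≤ d_T`); with `T = κM` both constants stay `O(1)`.
No `def : Prop`, no new fact; small `def`s (`SiteDeep`, `BlkDeep`, `blkIsoT`, `pullT`); standard axioms.
HONEST SCOPE. Pure lattice geometry of p21's block graphs (integer torus `Π[0, N₀_μ)`, blocks `bset`, bonds `bond`/`bondT`); nothing analytic; the depth of a
concrete central cube's data is the consumer's input; NOT summit progress.  Unit `lit-balaban-p38` (gen 25), 2026-08-23.
-/

namespace Literature.MathematicalPhysics.QuantumFieldTheory.Balaban1983to89.B6TorusDepthDistance

open Literature.MathematicalPhysics.QuantumFieldTheory.Balaban1983to89.B4ContourShift (supNorm abs_le_supNorm supNorm_nonneg exists_supNorm_eq)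
open Literature.MathematicalPhysics.QuantumFieldTheory.Balaban1983to89.B4Reflection242 (boxDom mem_boxDom)
open Literature.MathematicalPhysics.QuantumFieldTheory.Balaban1983to89.B4TorusKernel.MultiPeriod (circAbs torusSupNorm)
open Literature.MathematicalPhysics.QuantumFieldTheory.Balaban1983to89.B6MultiLevelBoxOperator (Domains N0)
open Literature.MathematicalPhysics.QuantumFieldTheory.Balaban1983to89.B6MultiLevelTorusOperator (TDomains one_le_of_mem)
open Literature.MathematicalPhysics.QuantumFieldTheory.Balaban1983to89.B6Geom246MultiLevelBox (bset blkOf coord_bounds Touch bond bond_adj scale_bounds)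
open Literature.MathematicalPhysics.QuantumFieldTheory.Balaban1983to89.B6Geom246MultiLevelTorus (TouchT bondT bondT_adj connectedT levelGapT)
open Literature.MathematicalPhysics.QuantumFieldTheory.Balaban1983to89.B6Geometry (LevelGap)

variable {d : ℕ}

/-! ## §1  No short wrap-around from a deep site -/

/-- **`min(|a − b|, w) ≤ circAbs N (a − b)`** for `0 ≤ b < N` and `0 < w ≤ a`, `a + w ≤ N`. [cite: Balaban1984PropagatorsII, (2.46) p.231, dictionary (torus vs box)] -/
theorem min_le_circAbs_sub {N : ℕ} {a b w : ℤ} (hb0 : 0 ≤ b) (hbN : b < N) (hw : 0 < w) (hwa : w ≤ a) (haw : a + w ≤ N) :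
    min |a - b| w ≤ circAbs N (a - b) := by
  unfold circAbs
  by_cases h : 0 ≤ a - b
  · have hmod : (a - b) % (N : ℤ) = a - b := Int.emod_eq_of_lt h (by omega)
    rw [hmod, abs_of_nonneg h]
    exact le_min (min_le_left _ _) ((min_le_right _ _).trans (by omega))
  · push Not at h
    have hx0 : 0 ≤ a - b + N := by omega
    have hxN : a - b + N < N := by omega
    have hmod : (a - b) % (N : ℤ) = a - b + N := by
      have key := Int.add_mul_emod_self_left (a - b + N) (N : ℤ) (-1)
      rw [Int.emod_eq_of_lt hx0 hxN] at key
      have e : a - b + (N : ℤ) + (N : ℤ) * -1 = a - b := by ring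
      rwa [e] at key
    rw [hmod, abs_of_neg h]
    exact le_min ((min_le_right _ _).trans (by omega)) ((min_le_left _ _).trans (by omega))

/-- **A SITE IS `w`-DEEP** in the fundamental box `Π[0, N_μ)`: `w ≤ x_μ` and `x_μ + w ≤ N_μ` for every `μ`. [cite: Balaban1984PropagatorsII, (2.36) p.229, dictionary] -/
def SiteDeep (N : Fin (d + 1) → ℕ) (w : ℤ) (x : Fin (d + 1) → ℤ) : Prop := ∀ μ, w ≤ x μ ∧ x μ + w ≤ N μ

/-- deepness is monotone in the depth. [cite: Balaban1984PropagatorsII, (2.36) p.229, dictionary] -/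
theorem SiteDeep.mono {N : Fin (d + 1) → ℕ} {w w' : ℤ} {x : Fin (d + 1) → ℤ} (h : SiteDeep N w x) (hw : w' ≤ w) : SiteDeep N w' x :=
  fun μ => ⟨hw.trans (h μ).1, by linarith [(h μ).2]⟩

/-- **NO SHORT WRAP-AROUND FROM A DEEP SITE**: `min(|x − x′|_∞, w) ≤ |x − x′|_T` for `x` `w`-deep and `x′` in the fundamental box.
[cite: Balaban1984PropagatorsII, (2.46) p.231, dictionary (torus vs box)] -/
theorem min_le_torusSupNorm_sub {N : Fin (d + 1) → ℕ} {w : ℤ} {x x' : Fin (d + 1) → ℤ} (hw : 0 < w) (hx : SiteDeep N w x) (hx' : x' ∈ boxDom N) :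
    min (supNorm (x - x')) (w : ℝ) ≤ torusSupNorm N (x - x') := by
  obtain ⟨μ, hμ⟩ := exists_supNorm_eq (x - x')
  obtain ⟨h0, hN⟩ := (mem_boxDom.1 hx') μ
  have key := min_le_circAbs_sub (N := N μ) h0 hN hw (hx μ).1 (hx μ).2
  have hle : ((circAbs (N μ) ((x - x') μ) : ℤ) : ℝ) ≤ torusSupNorm N (x - x') :=
    Finset.le_sup' (fun i => ((circAbs (N i) ((x - x') i) : ℤ) : ℝ)) (Finset.mem_univ μ)
  have key' : ((min |x μ - x' μ| w : ℤ) : ℝ) ≤ ((circAbs (N μ) ((x - x') μ) : ℤ) : ℝ) := by exact_mod_cast key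
  rw [hμ]
  have e1 : min (((|(x - x') μ| : ℤ) : ℝ)) (w : ℝ) = ((min |x μ - x' μ| w : ℤ) : ℝ) := by rw [Int.cast_min, Pi.sub_apply]
  rw [e1]
  exact key'.trans hle

/-! ## §2  Deep blocks: torus-touching is box-touching, and touching loses at most one block side of depth -/
section Blocks
variable {ℓ Mh k R : ℕ} {P : Fin (d + 1) → ℕ}

/-- **A BLOCK IS `w`-DEEP**: all its sites are `w`-deep. [cite: Balaban1984PropagatorsII, (2.36) p.229 with (2.45) p.231, dictionary] -/
def BlkDeep (D : Domains d ℓ Mh k P R) (w : ℤ) (s : ↥(bset D)) : Prop :=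
  ∀ x : ↥(boxDom (N0 ℓ Mh k P)), blkOf D x = s → SiteDeep (N0 ℓ Mh k P) w x.1

/-- deepness of blocks is monotone in the depth. [cite: Balaban1984PropagatorsII, (2.45) p.231, dictionary] -/
theorem BlkDeep.mono {D : Domains d ℓ Mh k P R} {w w' : ℤ} {s : ↥(bset D)} (h : BlkDeep D w s) (hw : w' ≤ w) : BlkDeep D w' s :=
  fun x hx => (h x hx).mono hw

/-- **A BLOCK IS DEEP IF ITS CORNER IS**: `w ≤ L^j·y_μ` and `L^j·y_μ + L^j + w ≤ N₀_μ + 1` make the block `(j, y)` `w`-deep.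
[cite: Balaban1984PropagatorsII, (2.1) p.224 with (2.45) p.231, dictionary] -/
theorem blkDeep_of_corner {D : Domains d ℓ Mh k P R} {w : ℤ} {s : ↥(bset D)}
    (h : ∀ μ, w ≤ (((ℓ + 1) ^ s.1.1 : ℕ) : ℤ) * s.1.2 μ ∧ (((ℓ + 1) ^ s.1.1 : ℕ) : ℤ) * s.1.2 μ + (((ℓ + 1) ^ s.1.1 : ℕ) : ℤ) + w ≤ N0 ℓ Mh k P μ + 1) :
    BlkDeep D w s := by
  intro x hx μ
  obtain ⟨h1, h2⟩ := coord_bounds D hx μ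
  obtain ⟨h3, h4⟩ := h μ
  constructor <;> omega

/-- **A 2-DEEP BLOCK TOUCHING A BLOCK ON THE TORUS TOUCHES IT IN THE BOX.** [cite: Balaban1984PropagatorsII, (2.46) p.231, dictionary (torus vs box)] -/
theorem touch_of_touchT_deep {D : TDomains d ℓ Mh k P R} {s t : ↥(bset D.toDomains)} (hs : BlkDeep D.toDomains 2 s) (h : TouchT D s t) :
    Touch D.toDomains s t := by
  obtain ⟨x, x', hx, hx', hd⟩ := h
  refine ⟨x, x', hx, hx', ?_⟩
  have key := min_le_torusSupNorm_sub (by norm_num) (hs x hx) x'.2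
  have key' : min (supNorm (x.1 - x'.1)) ((2 : ℤ) : ℝ) ≤ 1 := key.trans hd
  rcases min_choice (supNorm (x.1 - x'.1)) ((2 : ℤ) : ℝ) with hm | hm
  · rwa [hm] at key'
  · rw [hm] at key'; norm_num at key'

/-- **TOUCHING LOSES AT MOST ONE BLOCK SIDE OF DEPTH**: a block of level `≤ i` touching (in the box) a `w`-deep block is `(w − L^i)`-deep.
[cite: Balaban1984PropagatorsII, (2.1) p.224 with (2.46) p.231, dictionary] -/
theorem blkDeep_of_touch {D : Domains d ℓ Mh k P R} {w : ℤ} {i : ℕ} {s t : ↥(bset D)} (hs : BlkDeep D w s) (h : Touch D s t) (ht : t.1.1 ≤ i) :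
    BlkDeep D (w - (((ℓ + 1) ^ i : ℕ) : ℤ)) t := by
  obtain ⟨x, x', hx, hx', hd⟩ := h
  intro x'' hx'' μ
  have hsx := hs x hx μ
  -- `|x_μ − x′_μ| ≤ 1`
  have h1 : ((|(x.1 - x'.1) μ| : ℤ) : ℝ) ≤ 1 := (abs_le_supNorm _ μ).trans hd
  have h1' : |x.1 μ - x'.1 μ| ≤ 1 := by exact_mod_cast h1
  -- `x′` and `x″` lie in the block `t` of side `L^{j(t)} ≤ L^i`
  obtain ⟨a1, a2⟩ := coord_bounds D hx' μ
  obtain ⟨b1, b2⟩ := coord_bounds D hx'' μ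
  have hpow : (((ℓ + 1) ^ t.1.1 : ℕ) : ℤ) ≤ (((ℓ + 1) ^ i : ℕ) : ℤ) := by exact_mod_cast Nat.pow_le_pow_right (by omega) ht
  rw [abs_le] at h1'
  constructor <;> omega

end Blocks
/-! ## §3  A short torus contour from a deep block through low-level blocks is a box contour -/
section Walks
variable {ℓ Mh k R : ℕ} {P : Fin (d + 1) → ℕ} {D : TDomains d ℓ Mh k P R}

/-- **A TORUS CONTOUR OF `n` ADMISSIBLE BONDS FROM A `w`-DEEP BLOCK THROUGH BLOCKS OF LEVEL `≤ i`, `2 + n·L^i ≤ w`, IS A BOX CONTOUR** (of the same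
length). [cite: Balaban1984PropagatorsII, (2.46) p.231, dictionary (torus vs box)] -/
theorem boxWalk_of_torusWalk_deep {i : ℕ} :
    ∀ {a x : ↥(bset D.toDomains)} (p : (bondT D).Walk a x) {w : ℤ}, BlkDeep D.toDomains w a → (∀ v ∈ p.support, v.1.1 ≤ i) →
      2 + (p.length : ℤ) * (((ℓ + 1) ^ i : ℕ) : ℤ) ≤ w → ∃ q : (bond D.toDomains).Walk a x, q.length = p.length := by
  intro a x p
  induction p with
  | nil => intro w _ _ _; exact ⟨SimpleGraph.Walk.nil, rfl⟩
  | @cons a b c hab p ih =>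
    intro w ha hlev hw
    have hLi : (0 : ℤ) ≤ (((ℓ + 1) ^ i : ℕ) : ℤ) := by positivity
    have hlen : ((SimpleGraph.Walk.cons hab p).length : ℤ) = (p.length : ℤ) + 1 := by
      rw [SimpleGraph.Walk.length_cons]; push_cast; ring
    rw [hlen] at hw
    obtain ⟨hne, htouch⟩ := bondT_adj.1 hab
    have ha2 : BlkDeep D.toDomains 2 a := ha.mono (by nlinarith)
    have hbox : Touch D.toDomains a b := touch_of_touchT_deep ha2 htouch
    have hadj : (bond D.toDomains).Adj a b := bond_adj.2 ⟨hne, hbox⟩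
    have hb_lev : b.1.1 ≤ i := hlev b (by simp)
    have hb : BlkDeep D.toDomains (w - (((ℓ + 1) ^ i : ℕ) : ℤ)) b := blkDeep_of_touch ha hbox hb_lev
    have hlev' : ∀ v ∈ p.support, v.1.1 ≤ i := fun v hv => hlev v (by simp [hv])
    obtain ⟨q, hq⟩ := ih hb hlev' (by linarith)
    exact ⟨SimpleGraph.Walk.cons hadj q, by simp [hq]⟩

/-- **THE TRICHOTOMY**: for a `w`-deep block `a` and any block `x`, with `n := d_T(a, x)` the torus distance (2.46): EITHER the box distance is `n` too, OR
`w < 2 + n·L^{j(a)+1}` (the contour is long at the scale of `a`), OR `R·(L·M_h) ≤ n` (the contour climbs two levels, (2.60)).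
[cite: Balaban1984PropagatorsII, (2.46) p.231 with (2.60) p.233, dictionary (torus vs box)] -/
theorem distT_trichotomy (hMh : 1 ≤ Mh) (hP : ∀ μ, 1 ≤ P μ) {w : ℤ} {a : ↥(bset D.toDomains)} (ha : BlkDeep D.toDomains w a)
    (x : ↥(bset D.toDomains)) :
    (bond D.toDomains).dist a x = (bondT D).dist a x ∨
      w < 2 + ((bondT D).dist a x : ℤ) * (((ℓ + 1) ^ (a.1.1 + 1) : ℕ) : ℤ) ∨ R * ((ℓ + 1) * Mh) ≤ (bondT D).dist a x := by
  obtain ⟨p, hp⟩ := (connectedT (D := D) hMh hP).exists_walk_length_eq_dist a x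
  by_cases hclimb : ∃ v ∈ p.support, a.1.1 + 2 ≤ v.1.1
  · -- the contour climbs two levels: (2.60) on the torus
    obtain ⟨v, hv, hv2⟩ := hclimb
    right; right
    have hgap : R * ((ℓ + 1) * Mh) - 1 + 1 ≤ (p.takeUntil v hv).length :=
      levelGapT (D := D) (i := a.1.1 + 1) (u := a) (x := v) (show a.1.1 < a.1.1 + 1 by omega) (show a.1.1 + 1 < v.1.1 by omega)
        (p.takeUntil v hv)
    have hlen := p.length_takeUntil_le_length hv
    rw [← hp]
    have : R * ((ℓ + 1) * Mh) ≤ p.length := by omega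
    exact_mod_cast this
  · push Not at hclimb
    have hlev : ∀ v ∈ p.support, v.1.1 ≤ a.1.1 + 1 := fun v hv => by have := hclimb v hv; omega
    by_cases hw : 2 + (p.length : ℤ) * (((ℓ + 1) ^ (a.1.1 + 1) : ℕ) : ℤ) ≤ w
    · left
      obtain ⟨q, hq⟩ := boxWalk_of_torusWalk_deep p ha hlev hw
      refine le_antisymm ?_ ?_
      · calc (bond D.toDomains).dist a x ≤ q.length := SimpleGraph.dist_le q
          _ = _ := by rw [hq, hp]
      · exact B6Geom246MultiLevelTorus.distT_le_dist_box D hMh hP a x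
    · right; left
      rw [← hp]; push Not at hw; exact hw

/-- **REAL-VALUED COROLLARY `d_T ≥ min(d_box, (w − 2)/L^{j(a)+1}, R·M)`** in the form used by the (2.134) binders: if `d_T(a, x) < (w − 2)/L^{j(a)+1}` and
`d_T(a, x) < R·(L·M_h)` then `d_box(a, x) = d_T(a, x)`. [cite: Balaban1984PropagatorsII, (2.46) p.231 with (2.60) p.233, dictionary (torus vs box)] -/
theorem dist_box_eq_distT_of_lt (hMh : 1 ≤ Mh) (hP : ∀ μ, 1 ≤ P μ) {w : ℤ} {a : ↥(bset D.toDomains)} (ha : BlkDeep D.toDomains w a)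
    (x : ↥(bset D.toDomains)) (h1 : ((bondT D).dist a x : ℝ) * (((ℓ + 1) ^ (a.1.1 + 1) : ℕ) : ℝ) ≤ (w : ℝ) - 2)
    (h2 : ((bondT D).dist a x : ℝ) < (R : ℝ) * (((ℓ : ℝ) + 1) * Mh)) :
    ((bond D.toDomains).dist a x : ℝ) = (bondT D).dist a x := by
  rcases distT_trichotomy hMh hP ha x with h | h | h
  · exact_mod_cast h
  · exfalso
    have h' : ((w : ℤ) : ℝ) < 2 + ((bondT D).dist a x : ℝ) * (((ℓ + 1) ^ (a.1.1 + 1) : ℕ) : ℝ) := by exact_mod_cast h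
    linarith
  · exfalso
    have h' : (R : ℝ) * (((ℓ : ℝ) + 1) * Mh) ≤ (bondT D).dist a x := by exact_mod_cast h
    linarith

end Walks
/-! ## §4  The translation charts are isometries of the torus distance (2.46) -/
section Chart
variable {ℓ Mh k R : ℕ} {P : Fin (d + 1) → ℕ} {D : TDomains d ℓ Mh k P R}

open Literature.MathematicalPhysics.QuantumFieldTheory.Balaban1983to89.B6MultiLevelTorusOperator (tshift torusSupNorm_tshift_sub)
open Literature.MathematicalPhysics.QuantumFieldTheory.Balaban1983to89.B6Geom246MultiLevelTorus (blkMap blkMap_blkOf blkMap_injective blkMap_surjective)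

/-- **TOUCHING IS CHART-INVARIANT ON THE TORUS**: two blocks of the chart family `D.chart s` touch on ITS torus iff their images under p21's block map
touch on the torus of `D` (the chart is a torus translation). [cite: Balaban1984PropagatorsII, (2.46) p.231, dictionary (charts)] -/
theorem touchT_chart_iff (hMh : 1 ≤ Mh) (hP : ∀ μ, 1 ≤ P μ) (s : Fin (d + 1) → ℤ) {b b' : ↥(bset (D.chart s).toDomains)} :
    TouchT (D.chart s) b b' ↔ TouchT D (blkMap D s b) (blkMap D s b') := by
  constructor
  · rintro ⟨x, x', hx, hx', hd⟩
    refine ⟨tshift _ (TDomains.tvec ℓ Mh k s) x, tshift _ (TDomains.tvec ℓ Mh k s) x', ?_, ?_, ?_⟩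
    · rw [← hx, blkMap_blkOf hMh hP]
    · rw [← hx', blkMap_blkOf hMh hP]
    · rwa [torusSupNorm_tshift_sub]
  · rintro ⟨y, y', hy, hy', hd⟩
    refine ⟨(tshift _ (TDomains.tvec ℓ Mh k s)).symm y, (tshift _ (TDomains.tvec ℓ Mh k s)).symm y', ?_, ?_, ?_⟩
    · apply blkMap_injective hMh hP s
      rw [blkMap_blkOf hMh hP, Equiv.apply_symm_apply, hy]
    · apply blkMap_injective hMh hP s
      rw [blkMap_blkOf hMh hP, Equiv.apply_symm_apply, hy']
    · have e := torusSupNorm_tshift_sub (N0 ℓ Mh k P) (TDomains.tvec ℓ Mh k s) ((tshift _ (TDomains.tvec ℓ Mh k s)).symm y)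
        ((tshift _ (TDomains.tvec ℓ Mh k s)).symm y')
      rw [Equiv.apply_symm_apply, Equiv.apply_symm_apply] at e
      rw [e] at hd
      exact hd

/-- the torus adjacency is chart-invariant. [cite: Balaban1984PropagatorsII, (2.46) p.231, dictionary (charts)] -/
theorem bondT_adj_chart_iff (hMh : 1 ≤ Mh) (hP : ∀ μ, 1 ≤ P μ) (s : Fin (d + 1) → ℤ) {b b' : ↥(bset (D.chart s).toDomains)} :
    (bondT (D.chart s)).Adj b b' ↔ (bondT D).Adj (blkMap D s b) (blkMap D s b') := by
  rw [bondT_adj, bondT_adj, touchT_chart_iff hMh hP s, (blkMap_injective hMh hP s).ne_iff]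

/-- **THE BLOCK MAP IS AN ISOMORPHISM OF THE TORUS BOND GRAPHS** `bondT (D.chart s) ≃g bondT D`. [cite: Balaban1984PropagatorsII, (2.46) p.231, dictionary (charts)] -/
noncomputable def blkIsoT (hMh : 1 ≤ Mh) (hP : ∀ μ, 1 ≤ P μ) (s : Fin (d + 1) → ℤ) : bondT (D.chart s) ≃g bondT D where
  toEquiv := Equiv.ofBijective (blkMap D s) ⟨blkMap_injective hMh hP s, blkMap_surjective hMh hP s⟩
  map_rel_iff' := by
    intro b b'
    exact (bondT_adj_chart_iff hMh hP s).symm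

/-- **THE TORUS DISTANCE (2.46) IS CHART-INVARIANT**: `d_T(blkMap b, blkMap b′) = d_{T, chart}(b, b′)`. [cite: Balaban1984PropagatorsII, (2.46) p.231, dictionary (charts)] -/
theorem distT_chart_eq (hMh : 1 ≤ Mh) (hP : ∀ μ, 1 ≤ P μ) (s : Fin (d + 1) → ℤ) (b b' : ↥(bset (D.chart s).toDomains)) :
    (bondT D).dist (blkMap D s b) (blkMap D s b') = (bondT (D.chart s)).dist b b' := by
  refine le_antisymm ?_ ?_
  · obtain ⟨p, hp⟩ := (connectedT (D := D.chart s) hMh hP).exists_walk_length_eq_dist b b'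
    rw [← hp]
    calc (bondT D).dist (blkMap D s b) (blkMap D s b') ≤ (p.map (blkIsoT hMh hP s).toHom).length := SimpleGraph.dist_le _
      _ = p.length := SimpleGraph.Walk.length_map _ _
  · obtain ⟨p, hp⟩ := (connectedT (D := D) hMh hP).exists_walk_length_eq_dist (blkMap D s b) (blkMap D s b')
    rw [← hp]
    have hb : (blkIsoT hMh hP s).symm (blkMap D s b) = b := (blkIsoT hMh hP s).symm_apply_apply b
    have hb' : (blkIsoT hMh hP s).symm (blkMap D s b') = b' := (blkIsoT hMh hP s).symm_apply_apply b'
    calc (bondT (D.chart s)).dist b b' ≤ ((p.map (blkIsoT hMh hP s).symm.toHom).copy hb hb').length := SimpleGraph.dist_le _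
      _ = p.length := by rw [SimpleGraph.Walk.length_copy, SimpleGraph.Walk.length_map]

/-- **THE CONSUMER'S FORM** (route (A) of GAPS G-B6-p38-04): for a `w`-deep block `a` of the CHART family and any chart block `x`, if the torus distance of the
images is `< (w − 2)/L^{j(a)+1}` and `< R·(L·M_h)`, then it EQUALS the chart's box distance — so a box-metric Lipschitz/gap bound for data supported near a
central cube, read through the chart, is a torus-metric bound up to the threshold `min((w − 2)/L^{j+1}, R·M)`.
[cite: Balaban1984PropagatorsII, (2.46) p.231 with (2.60) p.233 and (2.36) p.229, dictionary (charts)] -/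
theorem dist_chart_eq_distT_of_lt (hMh : 1 ≤ Mh) (hP : ∀ μ, 1 ≤ P μ) (s : Fin (d + 1) → ℤ) {w : ℤ} {a : ↥(bset (D.chart s).toDomains)}
    (ha : BlkDeep (D.chart s).toDomains w a) (x : ↥(bset (D.chart s).toDomains))
    (h1 : ((bondT D).dist (blkMap D s a) (blkMap D s x) : ℝ) * (((ℓ + 1) ^ (a.1.1 + 1) : ℕ) : ℝ) ≤ (w : ℝ) - 2)
    (h2 : ((bondT D).dist (blkMap D s a) (blkMap D s x) : ℝ) < (R : ℝ) * (((ℓ : ℝ) + 1) * Mh)) :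
    ((bond (D.chart s).toDomains).dist a x : ℝ) = (bondT D).dist (blkMap D s a) (blkMap D s x) := by
  rw [distT_chart_eq hMh hP s] at h1 h2 ⊢
  exact dist_box_eq_distT_of_lt hMh hP ha x h1 h2

end Chart
/-! ## §5  Transfer of the two (2.134) binders — block-Lipschitz and the core gap — from a chart's box metric to the torus metric -/
section Transfer
variable {ℓ Mh k R : ℕ} {P : Fin (d + 1) → ℕ} {D : TDomains d ℓ Mh k P R}

open Literature.MathematicalPhysics.QuantumFieldTheory.Balaban1983to89.B6MultiLevelTorusOperator (tshift)
open Literature.MathematicalPhysics.QuantumFieldTheory.Balaban1983to89.B6Geom246MultiLevelTorus (blkMap blkMap_blkOf)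

/-- **THE TRANSPORTED FUNCTION** `f_T(y) := f(σ_s⁻¹ y)` of a function on the chart's sites (e.g. the `h_□`, `ζ_□` of a chart-central cube).
[cite: Balaban1984PropagatorsII, (2.36) p.229, dictionary (charts)] -/
def pullT (s : Fin (d + 1) → ℤ) (f : ↥(boxDom (N0 ℓ Mh k P)) → ℝ) : ↥(boxDom (N0 ℓ Mh k P)) → ℝ :=
  fun y => f ((tshift (N0 ℓ Mh k P) (TDomains.tvec ℓ Mh k s)).symm y)

/-- unfolding `pullT`. [cite: Balaban1984PropagatorsII, (2.36) p.229, dictionary (charts)] -/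
@[simp] theorem pullT_apply (s : Fin (d + 1) → ℤ) (f : ↥(boxDom (N0 ℓ Mh k P)) → ℝ) (y : ↥(boxDom (N0 ℓ Mh k P))) :
    pullT s f y = f ((tshift (N0 ℓ Mh k P) (TDomains.tvec ℓ Mh k s)).symm y) := rfl

/-- the torus block of `y` is the image of the chart block of `σ_s⁻¹ y`. [cite: Balaban1984PropagatorsII, (2.45) p.231, dictionary (charts)] -/
theorem blkOf_eq_blkMap_symm (hMh : 1 ≤ Mh) (hP : ∀ μ, 1 ≤ P μ) (s : Fin (d + 1) → ℤ) (y : ↥(boxDom (N0 ℓ Mh k P))) :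
    blkOf D.toDomains y = blkMap D s (blkOf (D.chart s).toDomains ((tshift (N0 ℓ Mh k P) (TDomains.tvec ℓ Mh k s)).symm y)) := by
  rw [blkMap_blkOf hMh hP, Equiv.apply_symm_apply]

/-- the ordered case of the Lipschitz transfer: `f(x) ≠ 0`. [cite: Balaban1984PropagatorsII, p.247 («h_□′(x′) − h_□′(x) … O(1)M^{−1}d(y, y′)»), dictionary (charts)] -/
theorem lip_transfer_aux (hMh : 1 ≤ Mh) (hP : ∀ μ, 1 ≤ P μ) (s : Fin (d + 1) → ℤ) {f : ↥(boxDom (N0 ℓ Mh k P)) → ℝ} {w : ℤ} {j : ℕ}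
    {sL r₀ M T : ℝ} (hMpos : 0 < M) (hT : 0 < T) (hr₀ : 0 ≤ r₀) (hsL : 0 ≤ sL) (hf1 : ∀ x, |f x| ≤ 1)
    (hdeep : ∀ x, f x ≠ 0 → BlkDeep (D.chart s).toDomains w (blkOf (D.chart s).toDomains x) ∧ (blkOf (D.chart s).toDomains x).1.1 ≤ j + 1)
    (hTw : T * (((ℓ + 1) ^ (j + 2) : ℕ) : ℝ) ≤ (w : ℝ) - 2) (hTR : T < (R : ℝ) * (((ℓ : ℝ) + 1) * Mh))
    (hLip : ∀ x x', |f x' - f x| ≤ sL / M * (((bond (D.chart s).toDomains).dist (blkOf (D.chart s).toDomains x) (blkOf (D.chart s).toDomains x') : ℝ) + r₀))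
    {x x' : ↥(boxDom (N0 ℓ Mh k P))} (hx : f x ≠ 0) :
    |f x' - f x| ≤ max sL (2 * M / T) / M *
      (((bondT D).dist (blkMap D s (blkOf (D.chart s).toDomains x)) (blkMap D s (blkOf (D.chart s).toDomains x')) : ℝ) + r₀) := by
  obtain ⟨ha, hlev⟩ := hdeep x hx
  set a := blkOf (D.chart s).toDomains x with ha_def
  set a' := blkOf (D.chart s).toDomains x' with ha'_def
  set n : ℝ := ((bondT D).dist (blkMap D s a) (blkMap D s a') : ℝ) with hn
  have hn0 : 0 ≤ n := by rw [hn]; positivity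
  have hmax0 : 0 ≤ max sL (2 * M / T) := le_max_of_le_left hsL
  by_cases hnT : n ≤ T
  · -- short: the torus distance is the chart's box distance
    have hpow : (((ℓ + 1) ^ (a.1.1 + 1) : ℕ) : ℝ) ≤ (((ℓ + 1) ^ (j + 2) : ℕ) : ℝ) := by
      exact_mod_cast Nat.pow_le_pow_right (by omega) (by omega)
    have h1 : n * (((ℓ + 1) ^ (a.1.1 + 1) : ℕ) : ℝ) ≤ (w : ℝ) - 2 :=
      (mul_le_mul hnT hpow (by positivity) hT.le).trans hTw
    have heq := dist_chart_eq_distT_of_lt hMh hP s ha a' h1 (lt_of_le_of_lt hnT hTR)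
    calc |f x' - f x| ≤ sL / M * (((bond (D.chart s).toDomains).dist a a' : ℝ) + r₀) := hLip x x'
      _ = sL / M * (n + r₀) := by rw [heq]
      _ ≤ max sL (2 * M / T) / M * (n + r₀) :=
          mul_le_mul_of_nonneg_right (div_le_div_of_nonneg_right (le_max_left _ _) hMpos.le) (by linarith)
  · -- long: `|f x′ − f x| ≤ 2 ≤ (2M/T)/M · n`
    push Not at hnT
    have h2 : |f x' - f x| ≤ 2 := by
      have := abs_sub (f x') (f x); linarith [hf1 x, hf1 x']
    have h3 : (2 : ℝ) ≤ 2 * M / T / M * (n + r₀) := by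
      rw [show 2 * M / T / M = 2 / T by field_simp]
      rw [div_mul_eq_mul_div, le_div_iff₀ hT]
      nlinarith
    calc |f x' - f x| ≤ 2 := h2
      _ ≤ 2 * M / T / M * (n + r₀) := h3
      _ ≤ max sL (2 * M / T) / M * (n + r₀) :=
          mul_le_mul_of_nonneg_right (div_le_div_of_nonneg_right (le_max_right _ _) hMpos.le) (by linarith)

/-- **TRANSFER OF THE BLOCK-LIPSCHITZ BINDER** `hLip` of (2.134): a function `f` on the chart's sites with `|f| ≤ 1`, supported in `w`-deep blocks of level
`≤ j + 1`, block-Lipschitz `(s/M)(d_box + r₀)` in the CHART'S BOX metric, is — transported to the torus — block-Lipschitz `(s′/M)(d_T + r₀)` in the TORUS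
metric, `s′ = max(s, 2M/T)` for any threshold `T > 0` with `T·L^{j+2} ≤ w − 2`, `T < R·M` (`T = κM` in the application, so `s′ = max(s, 2/κ)`).
[cite: Balaban1984PropagatorsII, p.247 («h_□′(x′) − h_□′(x) can be estimated by O(1)M^{−1}d(y, y′)») with (2.46) p.231, dictionary (charts)] -/
theorem lip_transfer (hMh : 1 ≤ Mh) (hP : ∀ μ, 1 ≤ P μ) (s : Fin (d + 1) → ℤ) {f : ↥(boxDom (N0 ℓ Mh k P)) → ℝ} {w : ℤ} {j : ℕ}
    {sL r₀ M T : ℝ} (hMpos : 0 < M) (hT : 0 < T) (hr₀ : 0 ≤ r₀) (hsL : 0 ≤ sL) (hf1 : ∀ x, |f x| ≤ 1)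
    (hdeep : ∀ x, f x ≠ 0 → BlkDeep (D.chart s).toDomains w (blkOf (D.chart s).toDomains x) ∧ (blkOf (D.chart s).toDomains x).1.1 ≤ j + 1)
    (hTw : T * (((ℓ + 1) ^ (j + 2) : ℕ) : ℝ) ≤ (w : ℝ) - 2) (hTR : T < (R : ℝ) * (((ℓ : ℝ) + 1) * Mh))
    (hLip : ∀ x x', |f x' - f x| ≤ sL / M * (((bond (D.chart s).toDomains).dist (blkOf (D.chart s).toDomains x) (blkOf (D.chart s).toDomains x') : ℝ) + r₀)) :
    ∀ y y', |pullT s f y' - pullT s f y| ≤ max sL (2 * M / T) / M * (((bondT D).dist (blkOf D.toDomains y) (blkOf D.toDomains y') : ℝ) + r₀) := by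
  intro y y'
  simp only [pullT_apply]
  rw [blkOf_eq_blkMap_symm hMh hP s y, blkOf_eq_blkMap_symm hMh hP s y']
  set x := (tshift (N0 ℓ Mh k P) (TDomains.tvec ℓ Mh k s)).symm y
  set x' := (tshift (N0 ℓ Mh k P) (TDomains.tvec ℓ Mh k s)).symm y'
  by_cases hx : f x ≠ 0
  · exact lip_transfer_aux hMh hP s hMpos hT hr₀ hsL hf1 hdeep hTw hTR hLip hx
  by_cases hx' : f x' ≠ 0
  · rw [abs_sub_comm, SimpleGraph.dist_comm]
    exact lip_transfer_aux hMh hP s hMpos hT hr₀ hsL hf1 hdeep hTw hTR hLip hx'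
  · push Not at hx hx'
    rw [hx, hx', sub_zero, abs_zero]
    have : 0 ≤ max sL (2 * M / T) := le_max_of_le_left hsL
    positivity

/-- **TRANSFER OF THE CORE-GAP BINDER** `hgap` of (2.134): if in the chart's box metric `m·M ≤ d_box(y, y″)` for `y ∉ Score`, `y″ ∈ S` with the blocks of `S`
`w`-deep of level `≤ j + 1`, then on the torus `min(m, T/M)·M ≤ d_T(blkMap y, blkMap y″)` (`T` as above).
[cite: Balaban1984PropagatorsII, p.247 («ζ_□(y) − 1 = 0 for d(y, y′) ≦ M») with (2.46) p.231, dictionary (charts)] -/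
theorem gap_transfer (hMh : 1 ≤ Mh) (hP : ∀ μ, 1 ≤ P μ) (s : Fin (d + 1) → ℤ) {S Score : Set ↥(bset (D.chart s).toDomains)} {w : ℤ} {j : ℕ}
    {m M T : ℝ} (hMpos : 0 < M) (hT : 0 < T) (hdeep : ∀ a ∈ S, BlkDeep (D.chart s).toDomains w a ∧ a.1.1 ≤ j + 1)
    (hTw : T * (((ℓ + 1) ^ (j + 2) : ℕ) : ℝ) ≤ (w : ℝ) - 2) (hTR : T < (R : ℝ) * (((ℓ : ℝ) + 1) * Mh))
    (hgap : ∀ y y'', y ∉ Score → y'' ∈ S → m * M ≤ ((bond (D.chart s).toDomains).dist y y'' : ℝ)) :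
    ∀ y y'', y ∉ Score → y'' ∈ S → min m (T / M) * M ≤ ((bondT D).dist (blkMap D s y) (blkMap D s y'') : ℝ) := by
  intro y y'' hy hy''
  obtain ⟨ha, hlev⟩ := hdeep y'' hy''
  rw [SimpleGraph.dist_comm]
  set n : ℝ := ((bondT D).dist (blkMap D s y'') (blkMap D s y) : ℝ) with hn
  by_cases hnT : n ≤ T
  · have hpow : (((ℓ + 1) ^ (y''.1.1 + 1) : ℕ) : ℝ) ≤ (((ℓ + 1) ^ (j + 2) : ℕ) : ℝ) := by
      exact_mod_cast Nat.pow_le_pow_right (by omega) (by omega)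
    have h1 : n * (((ℓ + 1) ^ (y''.1.1 + 1) : ℕ) : ℝ) ≤ (w : ℝ) - 2 :=
      (mul_le_mul hnT hpow (by positivity) hT.le).trans hTw
    have heq := dist_chart_eq_distT_of_lt hMh hP s ha y h1 (lt_of_le_of_lt hnT hTR)
    rw [SimpleGraph.dist_comm] at heq
    calc min m (T / M) * M ≤ m * M := mul_le_mul_of_nonneg_right (min_le_left _ _) hMpos.le
      _ ≤ ((bond (D.chart s).toDomains).dist y y'' : ℝ) := hgap y y'' hy hy''
      _ = n := heq
  · push Not at hnT
    calc min m (T / M) * M ≤ T / M * M := mul_le_mul_of_nonneg_right (min_le_right _ _) hMpos.le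
      _ = T := by field_simp
      _ ≤ n := hnT.le

end Transfer

end Literature.MathematicalPhysics.QuantumFieldTheory.Balaban1983to89.B6TorusDepthDistance
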